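import Mathlib.Algebra.Group.Subgroup.Defs
import Mathlib.Algebra.Group.Submonoid.Defs
import Mathlib.Algebra.Group.Pi.Lemmas
import Mathlib.Algebra.Order.Group.Nat
import Mathlib.Tactic.Abel
import HarnessLib

/-!
# The four-cone law for formally exact monomial («toric») complexes — combinatorial core

Cell `pub-hsemireg`, track S4-PUSH corner 1 (s4-search-1 g10), LEMMA FC / LEMMA FC-U of
`s4push/search-1/PREREG-1-23.md` (S4-PR-67) and its ADDENDUM A. HONEST FRAMING: pure monoid arithmetic on
exponent vectors `ι → ℕ` plus additive bookkeeping in an abelian group `Λ` through an additive map `φ`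
(«class of a monomial») and a submonoid `C` («effective or zero classes») containing every `φ x`.
Nothing here is a statement about any variety, line bundle or section, and nothing here bears on
HC / HC_CM / HC_AV. The geometric input of LEMMA FC (FACT E: effective B-classes lie in the closed future
cone) is NOT formalised here.

* `exists_gcd_split`: if `e₁ + f₁ = e₂ + f₂` in `ι → ℕ` then `e₁ = g + U`, `e₂ = g + W`, `f₁ = W + Q`,
  `f₂ = U + Q` with `U ⊓ W = 0` (the gcd split of two equal path monomials `x → m → y`, `x → m' → y`).
* `coprime_parts_eq` (LEMMA FC-U, uniqueness): the coprime pair is read off the source arcs alone AND off the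
  target arcs alone: `e₁ - e₁ ⊓ e₂ = f₂ - f₁ ⊓ f₂` and `e₂ - e₁ ⊓ e₂ = f₁ - f₁ ⊓ f₂`.
* `four_cone` (LEMMA FC at the class level): with `c_in = φ e₁`, `c_out = φ f₁`, `δ = φ e₁ - φ e₂` there are
  `u w ∈ C` with `u - w = δ`, `c_in - u ∈ C`, `c_out - w ∈ C`.
-/

namespace Summit.Ventures.HSemireg.FourConeLaw

variable {ι : Type*}

/-- **gcd split.** Two equal path exponents `e₁ + f₁ = e₂ + f₂` split through `g = e₁ ⊓ e₂` into coprime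
parts `U`, `W` and a common cofactor `Q`. -/
theorem exists_gcd_split (e₁ e₂ f₁ f₂ : ι → ℕ) (h : e₁ + f₁ = e₂ + f₂) :
    ∃ g U W Q : ι → ℕ,
      e₁ = g + U ∧ e₂ = g + W ∧ f₁ = W + Q ∧ f₂ = U + Q ∧ U ⊓ W = 0 := by
  refine ⟨e₁ ⊓ e₂, fun i => e₁ i - min (e₁ i) (e₂ i), fun i => e₂ i - min (e₁ i) (e₂ i),
    fun i => f₁ i - (e₂ i - min (e₁ i) (e₂ i)), ?_, ?_, ?_, ?_, ?_⟩
  all_goals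
    funext i
    have hi := congrFun h i
    simp only [Pi.add_apply, Pi.inf_apply, Pi.zero_apply] at hi ⊢
    rcases le_total (e₁ i) (e₂ i) with hle | hle
    · rw [min_eq_left hle]; omega
    · rw [min_eq_right hle]; omega

/-- **LEMMA FC-U (uniqueness of the coprime pair).** Under `e₁ + f₁ = e₂ + f₂` the part of `e₁` prime to `e₂`
equals the part of `f₂` prime to `f₁`, and symmetrically: the pair `(U, W)` is determined by the two source
arcs alone and by the two target arcs alone. -/
theorem coprime_parts_eq (e₁ e₂ f₁ f₂ : ι → ℕ) (h : e₁ + f₁ = e₂ + f₂) :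
    e₁ - e₁ ⊓ e₂ = f₂ - f₁ ⊓ f₂ ∧ e₂ - e₁ ⊓ e₂ = f₁ - f₁ ⊓ f₂ := by
  constructor
  all_goals
    funext i
    have hi := congrFun h i
    simp only [Pi.add_apply, Pi.inf_apply, Pi.sub_apply] at hi ⊢
    rcases le_total (e₁ i) (e₂ i) with hle | hle <;> rcases le_total (f₁ i) (f₂ i) with hle' | hle'
    all_goals
      first
      | (rw [min_eq_left hle, min_eq_left hle']; omega)
      | (rw [min_eq_left hle, min_eq_right hle']; omega)
      | (rw [min_eq_right hle, min_eq_left hle']; omega)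
      | (rw [min_eq_right hle, min_eq_right hle']; omega)

/-- **LEMMA FC (four-cone law, class level).** Let `φ` send exponent vectors additively to classes in an
abelian group `Λ`, with every `φ x` in the submonoid `C` («effective or zero»). If the path exponents through two
middles agree, `e₁ + f₁ = e₂ + f₂`, then with `c_in = φ e₁`, `c_out = φ f₁`, `δ = φ e₁ - φ e₂` there are
`u, w ∈ C` with `u - w = δ`, `c_in - u ∈ C` and `c_out - w ∈ C` (i.e. `δ ∈ D(c_in) ⊖ D(c_out)`). -/
theorem four_cone {Λ : Type*} [AddCommGroup Λ] (φ : (ι → ℕ) →+ Λ) (C : AddSubmonoid Λ)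
    (hC : ∀ x, φ x ∈ C) (e₁ e₂ f₁ f₂ : ι → ℕ) (h : e₁ + f₁ = e₂ + f₂) :
    ∃ u ∈ C, ∃ w ∈ C, u - w = φ e₁ - φ e₂ ∧ φ e₁ - u ∈ C ∧ φ f₁ - w ∈ C := by
  obtain ⟨g, U, W, Q, h1, h2, h3, -, -⟩ := exists_gcd_split e₁ e₂ f₁ f₂ h
  refine ⟨φ U, hC U, φ W, hC W, ?_, ?_, ?_⟩
  · rw [h1, h2, map_add, map_add]; abel
  · rw [h1, map_add, add_sub_cancel_right]; exact hC g
  · rw [h3, map_add, add_sub_cancel_left]; exact hC Q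

end Summit.Ventures.HSemireg.FourConeLaw
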